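/- Free-seat work of EXTRA WIDTH SEAT `ym-line-cbag-p1-w5` (prover-ym-line-cbag-p1-w5-g2-0), route `EguchiKawaiDirectionLadder`
(ideator ym-idea-2, LINE 8): the route-posited objects of the REGISTERED birth skeleton of crux `TripleSmallBallMargin`
(stmt-QuantumFields-27724; planner ym-idea-2 g6, HOME/l8/bc/TripleSmallBallMargin_birth_v2…v5.lean, registered skeleton sha
36f24ef1bdb02f84…; signatures unchanged since v2 a35b62d6…) VERBATIM, so that the two registered stubs
`stub_freeTripleSmallBall : FreeTripleSmallBall` (XL) and `stub_offBlockDecoupling : OffBlockDecoupling` (L) can be landed by name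
from importable definitions, and the planner's proofs of the glue obligations (d) `CentreSymmetricProfile` and (c) `MarginComposition`
(HOME/l8/bc/EguchiKawaiDirectionLadderPairMass.lean) can be landed against the same objects (sibling file
`EguchiKawaiDirectionLadderTripleSmallBallMarginProfile.lean`).  Definitions only; no claim.
The route bears on the barrier-ledger fact `EguchiKawaiBreakdown`; the Yang–Mills mass gap is NOT proved by anything here. -/
import Summits.QuantumFields.YangMills.Theses.EguchiKawaiDirectionLadder

/-!
# Route `EguchiKawaiDirectionLadder`, crux `TripleSmallBallMargin` (stmt-QuantumFields-27724): the skeleton's objects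

The crux `TripleSmallBallMargin`: `∃ δ e C, 0 < δ ∧ 3/4 < e ∧ EKSymSmallBallBound 3 δ e C` — the `d = 3` centre-symmetric
small-ball bound for Haar triples `(U₁,U₂,U₃) ∈ U(N)³` with SOME margin above the collapsed exponent `3/4`, uniformly in `N`.
The registered line of record (planner ym-idea-2 g6, skeletons v2–v5, critic idea-crit-4 PASS 2026-08-28) composes it from four
typed obligations — the two LEVELS of the block recursion displayed separately ((a), (b) = the registered stubs of skeleton v5;
(d), (c) = glue proved by the planner, landed in `EguchiKawaiDirectionLadderTripleSmallBallMarginProfile.lean`):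

* (a) `FreeTripleSmallBall` (XL, load-bearing): the unconstrained `N`-uniform small-ball UPPER bound for Haar triples with the
  Bhanot–Heller–Neuberger exponent `3/4 − η`;
* (b) `OffBlockDecoupling := FreeTripleSmallBall → ProfileResolvedBound` (L): at a fixed resolution `r`, configurations whose
  first link has spectral pair mass `pairMass r (U 0) ≤ S` have exponent at least `(3/4 − η)·S + (1 − η)·(1 − S)`;
* (d) `CentreSymmetricProfile` (M, deterministic circle geometry): `|tr U/N|² ≤ δ ⇒ pairMass r U ≤ (1 + δ)/2 + ε` for small `r`;
* (c) `MarginComposition := CentreSymmetricProfile → ProfileResolvedBound → TripleSmallBallMargin` (S): parameter choice and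
  the margin arithmetic.

This file only DECLARES these objects, byte-for-byte as in the registered skeleton (namespace moved from
`…Theses.EguchiKawaiDirectionLadder.BirthKA2` to the route's Theorems namespace; `MarginComposition` concludes the ROUTE decl
`Theses.EguchiKawaiDirectionLadder.TripleSmallBallMargin`, of which the skeleton's local `TripleSmallBallMargin` is a verbatim copy),
plus the kernel-checked composition `tripleSmallBallMargin_of_stubs`.  Nothing is claimed; no summit statement and no mass gap
is proved by declaring them.
-/

set_option autoImplicit false

noncomputable section

open MeasureTheory
open scoped Classical
open Literature.Barriers.QuantumFields

namespace Summit.QuantumFields.YangMills.Theorems.EguchiKawaiDirectionLadder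

/-- The spectrum of a unitary matrix as a multiset: the roots of the characteristic polynomial, with multiplicity
(`card = N` over `ℂ`).  Object of the registered skeleton of stmt-QuantumFields-27724, verbatim. -/
def spec {N : ℕ} (U : UN N) : Multiset ℂ :=
  (U : Matrix (Fin N) (Fin N) ℂ).charpoly.roots

/-- Pair mass of the spectrum at chordal resolution `r`: the fraction of ORDERED eigenvalue pairs (diagonal included) at chordal
distance `≤ r` — the finite-`N`, basis-free version of the cluster profile `Σ_a f_a²` (for `K` tight clusters of fractions `f_a`
pairwise `> r` apart it equals `Σ_a f_a²`).  Object of the registered skeleton of stmt-QuantumFields-27724, verbatim. -/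
def pairMass {N : ℕ} (r : ℝ) (U : UN N) : ℝ :=
  ((spec U).map fun z => ((((spec U).filter fun w => ‖z - w‖ ≤ r).card : ℕ) : ℝ)).sum / (N : ℝ) ^ 2

/-- STUB (a) of the registered skeleton of stmt-QuantumFields-27724 (XL, load-bearing), verbatim: WITHIN-CLUSTER LEVEL — the
unconstrained `N`-uniform small-ball upper bound for Haar triples with the BHN exponent `3/4 − η`. -/
def FreeTripleSmallBall : Prop :=
  ∀ η : ℝ, 0 < η → ∃ C : ℝ, 0 ≤ C ∧ ∃ N₀ : ℕ, ∀ N : ℕ, N₀ ≤ N → ∀ t : ℝ, 0 < t →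
    ekHaar 3 N {U | ekAction U ≤ t} ≤
      ENNReal.ofReal (Real.exp ((N : ℝ) ^ 2 * ((3 / 4 - η) * Real.log t + C)))

/-- The profile-resolved bound (conclusion of stub (b)), verbatim from the registered skeleton of stmt-QuantumFields-27724: at
fixed resolution `r`, configurations whose first link has pair mass `≤ S` have small-ball exponent at least
`(3/4 − η)·S + (1 − η)·(1 − S)` (within-cluster order-4 count on the mass `S`, off-block order-2 count `1/2 + 1/2` on `1 − S`). -/
def ProfileResolvedBound : Prop :=
  ∀ η r : ℝ, 0 < η → 0 < r → ∃ C : ℝ, 0 ≤ C ∧ ∃ N₀ : ℕ, ∀ N : ℕ, N₀ ≤ N →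
    ∀ t : ℝ, 0 < t → t ≤ 1 → ∀ S : ℝ,
      ekHaar 3 N ({U | ekAction U ≤ t} ∩ {U | pairMass r (U 0) ≤ S}) ≤
        ENNReal.ofReal (Real.exp ((N : ℝ) ^ 2 *
          (((3 / 4 - η) * S + (1 - η) * (1 - S)) * Real.log t + C)))

/-- STUB (b) of the registered skeleton of stmt-QuantumFields-27724 (L), verbatim: OFF-DIAGONAL-BLOCK LEVEL — near-block-diagonal
rigidity of `U₂, U₃` in the eigenbasis of `U₁` with the partition entropy bound, given the blockwise within-cluster bound (a).
HOW THE BOOKS ARE KEPT (critic idea-crit-4 note m1, 2026-08-28T12:30:03Z, adopted in skeleton v5): (i) the rigidity is ENTRYWISE,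
not clusterwise — `{pairMass r (U 0) ≤ S}` does NOT split the spectrum of `U 0` into `r`-separated clusters (Haar-typical `U 0` has
pair mass `≈ r/π` with chained arcs and no gap), so the statement used inside is `|λ_j − λ_k| > r ⇒ |(U₂)_{jk}|², |(U₃)_{jk}|² ≲ t/r²`
(order-2 count, the `(1 − η)(1 − S)` term); (ii) the cost of CLUSTERING `U 0` itself is booked through the Weyl/Vandermonde factor
`∏_{j<k} |λ_j − λ_k|²` of the spectrum of `U 0` (the `(1/4)·S` share of `U₁` inside `(3/4 − η)·S`), never borrowed from (a);
(iii) pairs inside the adjacent-arc band `|λ_j − λ_k| ≤ r` are charged to `S` up to a constant factor that must NOT multiply `S` in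
the exponent: the band is paid by the `[U₂,U₃]` constraint INSIDE the band, i.e. by (a) one level down — which is why the recursion
has exactly two levels; (iv) live risk = the collar of scales between `√t` and `r`. -/
def OffBlockDecoupling : Prop := FreeTripleSmallBall → ProfileResolvedBound

/-- Glue obligation (d) of the skeleton of stmt-QuantumFields-27724 (M, deterministic; a registered stub of v2, PROVED by the
planner in v3 and landed in the sibling file `…TripleSmallBallMarginProfile`), verbatim: centre symmetry of one link caps its pair
mass at `(1 + δ)/2 + ε`. -/
def CentreSymmetricProfile : Prop :=
  ∀ δ ε : ℝ, 0 < δ → δ ≤ 1 / 2 → 0 < ε → ∃ r : ℝ, 0 < r ∧ ∀ N : ℕ, 0 < N → ∀ U : UN N,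
    ‖Matrix.trace (U : Matrix (Fin N) (Fin N) ℂ) / (N : ℂ)‖ ^ 2 ≤ δ →
      pairMass r U ≤ (1 + δ) / 2 + ε

/-- Glue obligation (c) of the skeleton of stmt-QuantumFields-27724 (S; a registered stub of v2, PROVED by the planner in v3 and
landed in the sibling file `…TripleSmallBallMarginProfile`), verbatim up to the namespace of the conclusion: COMPOSITION — parameter choice + `Sym_δ ∩ {S_R ≤ t} ⊆ {S_R ≤ t} ∩ {pairMass ≤ S₀}` + the margin arithmetic turn (d) and the
profile-resolved bound into the route's crux. -/
def MarginComposition : Prop :=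
  CentreSymmetricProfile → ProfileResolvedBound →
    Summit.QuantumFields.YangMills.Theses.EguchiKawaiDirectionLadder.TripleSmallBallMargin

/-- Composition (as in the registered skeleton's `TripleSmallBallMargin_of a b d c := c d (b a)`): the two stubs and the two glue
obligations give the route's crux `TripleSmallBallMargin` by name.  Kernel-checked bookkeeping; nothing is proved about them here. -/
theorem tripleSmallBallMargin_of_stubs (ha : FreeTripleSmallBall) (hb : OffBlockDecoupling)
    (hd : CentreSymmetricProfile) (hc : MarginComposition) :
    Summit.QuantumFields.YangMills.Theses.EguchiKawaiDirectionLadder.TripleSmallBallMargin :=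
  hc hd (hb ha)

end Summit.QuantumFields.YangMills.Theorems.EguchiKawaiDirectionLadder

end
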